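import Literature.MathematicalPhysics.QuantumFieldTheory.Balaban1983to89.Node00.SmallFieldChiOfRecord
import Literature.MathematicalPhysics.QuantumFieldTheory.Balaban1983to89.BlockAveragingExpMeanLogContinuous
import Literature.MeasureTheory.RandomSets.MeasurableConstrainedArgmin

/-!
# NODE 00 — K0′ components G3, the definition-side hook of rows P1∕P2∕P3: a MEASURABLE SELECTOR of the (2.12) minimisers of record,
# and the one-token re-point `UminSelOfRecord` ∕ `bgSelOfRecord` under which (H-U) `LocalBgMeasurable` is a theorem

Cell `pub-ymgap`, NODE 00, prover seat `pub-ymgap-node00-def-K0c` (g2; director LINE №92 (3), R176; dag-lead NODE-TABLE § K0′ components rows P1∕P2∕P3,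
row (H-U)).  [III] = [Balaban1988Convergent], [I] = [Balaban1987RG1].

WHY.  This seat's g0 files (`Record12Measurability`, `…AnySelector`, `…AtRecord`) reduce the three measurability ∕ integrability fields
`intPiece`, `measω`, `measChi` of `Provisos₁₂.base` (and def-R's P6 (c1)) to ONE displayed clause (H-U): measurability of every local
background `V ↦ U_{k,□}(V) = U(𝐁_k(□), M˙(Q_k^{s*}V))` of (2.16) [III] over def-R's TOTALISED (2.12) solution map `UminOfRecord` — a bare
`Classical.choose` among the minimisers, hence measurable by NO argument (located-open «short of a measurable-selection theorem», def-R g7).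
THIS FILE proves that a MEASURABLE choice exists, for def-R's EXACT predicate `B15DeterminingSets.IsMinimizer (avOfRecord F N K) {U | PlaqSmall δ U} 𝔹`
([III] (2.12) p. 256: minimise the Wilson action over the small-plaquette class under the constraint `M_𝔹(U) = W` on a determining set):
* §1 topology of the configuration spaces `SU(N)^{bonds}` of record: the Wilson action (0.2) [I] is continuous (private copies of tree facts); the class `{U | PlaqSmall δ U}` is OPEN;
* §2 the exp-mean-log block averaging of record `avgFun expMeanLogSU` ((0.4) [I], the tree's total extension by `1` off the guard) is NOT continuous
  but continuous on each member of a countable CLOSED cover (`SigmaClosedContinuous`: guard atoms, `ExpMeanLog.continuousOn_coe_ESU`), hence so is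
  every iterate `M^j = Averaging.iter (avOfRecord F N K) j` and the joint map `U ↦ (M^j U)_{j ≤ J}`;
* §3 **`exists_measurable_isMinimizer_selector`**: for every torus `K`, threshold `δ`, and determining set `𝔹` supported on scales `≤ J` (every
  `𝐁_k(□)` of record, `Bj_eq_empty_of_lt`), there is a MEASURABLE `f : MSField → GaugeField … 0 SU(N)` with `IsMinimizer … W (f W)` whenever
  (2.12) has a minimiser at the datum `W`, and `f W = 1` otherwise — by `Literature.MeasureTheory.RandomSets.exists_measurable_constrained_argmin`
  (Castaing's compact-valued selection theorem, [RobinsonRodrigoSadowskiCUP2016] App. E, over the countably many compact pieces);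
* §4 THE OFFER (NOT a re-point of any carrier of record — LINE №102; for the successor-record field list beside P6∕P7): `UminSelOfRecord av reg 𝔹`
  = a measurable selector when one exists, else `UminOfRecord`; it satisfies THE SAME two interface lemmas as def-R's map
  (`isMinimizer_UminSelOfRecord`, `UminSelOfRecord_of_not`) PLUS `measurable_UminSelOfRecord` at every `𝐁_k(□)` of record; the datum
  `bgSelOfRecord : DetBackground` (same `reg`, same solvable domain); and **`measurable_ukBox_bgSel`**: every local background (2.16) over the
  re-pointed datum is measurable — literally the clause (H-U) `Record12Measurability.LocalBgMeasurable` with `bgOfRecord ↦ bgSelOfRecord`, so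
  that after that one-token re-point g0's FILE 1–3 discharge rows P1∕P2∕P3 at every `N`.
Cross-reference: at the UNIT datum any (2.12) minimiser is flat (`B15Claim189PinNonVacuity.plaqHol_eq_one_of_isMinimizer_avgFamily_one`, dag-n12-e),
selector-independently — it applies to `UminSelOfRecord` verbatim.
(v1.1, g3, §6) THE DETERMINED SELECTOR: `exists_measurable_isMinimizer_selector_determined(_Bj)` — §3's selector precomposed with the projection of the data onto
the bonds of `𝔹`, hence a selector that is moreover a FUNCTION OF THE MINIMAL ORBIT (`f W = f W′` whenever `W`, `W′` have the same (2.12) minimal configurations; at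
`𝔹 = ∅` constant) — the extra values-level clause under which every face the tree proves of def-R's pointwise choice survives a measurable re-point, in
particular dag-n13-e's `B16Thm1BaseAtRecord11.UbgOfRecord_zero_const`, whose argument is isolated here BY NAME as `UminOfRecord_congr_of_isMinimizer_iff`
(+ `agreeOn_of_isMinimizer_iff_of_exists`).  Theorems only; no decl of v1 touched.
(v1.2, g3, REBALANCE №62 S2′) `UminOfRecord_congr_of_isMinimizer_iff` gains ONE instance binder `[MeasurableSpace G]` (the signature `UminOfRecord` will carry under
FILE 1 v2′, director-ym №128 D1 (B)); statement otherwise and proof unchanged; nothing else touched.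

HONEST FRAMING — what this is NOT.  Kernel theorems about the tree's own objects (compactness of `SU(N)^{bonds}`, continuity of the Wilson action,
piecewise continuity of the tree's averaging, a selection theorem); (H-U) for the CURRENT `UminOfRecord` stays exactly as located (unprovable by
design); no carrier of record is re-pointed here; nothing of Bałaban's is asserted ([15] Thm 1 — existence∕uniqueness of the minimiser — is NOT
used: a selector needs neither); no `Provisos₁₂` field is inhabited, K0′ is NOT discharged, counts unmoved (5∕28).  One finite four-torus programme at
fixed `ε = L^{−K}` — NOT the continuum limit, NOT infinite volume, NOT OS, NOT a mass gap, NOT the Clay problem.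
-/

noncomputable section

open Set
open _root_.MeasureTheory _root_.TopologicalSpace

namespace Literature.MathematicalPhysics.QuantumFieldTheory.Balaban1983to89.Node00

open T4Continuum BlockAveraging ExpMeanLog AveragingRT B15DeterminingSets B14.Eq213DetSet B14.Eq216Concrete
open Literature.MeasureTheory.RandomSets
open Literature.MathematicalPhysics.QuantumLattice (fundamentalRep continuous_fundamentalRep fundamentalRep_injective)
open Literature.MathematicalPhysics.QuantumFieldTheory.BalabanImbrieJaffe1984to88.BIJ85Eq453GaugeField (qsstarG qsstarGIter0 qsstarG_apply
  qsstarGIter0_succ)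

/-! ## §1 Topology of the configuration spaces of record

The four continuity facts below exist in the tree (`B12ContinuousTransportInvarianceOn.continuous_dist1_SU` ∕ `continuous_plaqHol_SU`,
`B16Thm1BaseAtRecord11.continuous_wilsonAction4_SU`; Summits twins in `…/T4Continuum/Support/SubstrateBackground`); they are restated PRIVATELY
here so as not to import those chains (a definition-side Node00 file keeps the cone of `SmallFieldChiOfRecord` + the averaging modules). -/

section Topology

variable {N : ℕ} [NeZero N] {P : Params} {j : ℕ}

/-- `|· − 1|` (operator norm) is continuous on `SU(N)` (private copy of `B12ContinuousTransportInvarianceOn.continuous_dist1_SU`). [folklore] -/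
private theorem continuous_dist1_SU' : Continuous (dist1 : SU N → ℝ) :=
  UnitaryModel.continuous_opDist1.comp (continuous_fundamentalRep (Fin N))

/-- `Re tr` is continuous on `SU(N)` (private; cf. `QuantumLattice.GaugeGroupsProofs.continuous_reTr`). [folklore] -/
private theorem continuous_reTr_SU' : Continuous (reTr : SU N → ℝ) :=
  UnitaryModel.continuous_nReTr.comp (continuous_fundamentalRep (Fin N))

/-- Plaquette variables are continuous in the configuration (private copy of `B12ContinuousTransportInvarianceOn.continuous_plaqHol_SU`). [folklore] -/
private theorem continuous_plaqHol' (p : Plaq P j) : Continuous fun U : GaugeField P j (SU N) => GaugeField.plaqHol U p := by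
  have hb : ∀ b : PBond P j, Continuous fun U : GaugeField P j (SU N) => U b := fun b => continuous_apply b
  unfold GaugeField.plaqHol
  exact (((hb _).mul (hb _)).mul (hb _).inv).mul (hb _).inv

/-- The Wilson action (0.2) is a continuous function of the configuration (private copy of `B16Thm1BaseAtRecord11.continuous_wilsonAction4_SU`;
Summits twin `SubstrateBackground` :98). [folklore] -/
private theorem continuous_wilsonAction4' : Continuous (wilsonAction4 : GaugeField P j (SU N) → ℝ) := by
  unfold wilsonAction4 wilsonAction
  exact continuous_finsetSum _ fun p _ =>
    continuous_const.mul (continuous_const.sub (continuous_reTr_SU'.comp (continuous_plaqHol' p)))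

/-- **The small-plaquette class `{U | |U(∂p) − 1| < δ ∀p}` (the regularity class of (2.12)) is OPEN.** [cite: Balaban1987RG1, (0.18) p.255 (bookkeeping)] -/
theorem isOpen_plaqSmall (δ : ℝ) : IsOpen {U : GaugeField P j (SU N) | PlaqSmall δ U} := by
  simp only [PlaqSmall, setOf_forall]
  exact isOpen_iInter_of_finite fun p => isOpen_lt (continuous_dist1_SU'.comp (continuous_plaqHol' p)) continuous_const

end Topology

/-! ## §2 The exp-mean-log block averaging of record is continuous on the members of a countable closed cover -/

section Averaging

variable {N : ℕ} [NeZero N] {P : Params} {j : ℕ}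

/-- The small-field guard `{U | Small U c}` of (0.4) at a coarse bond is OPEN (loop variables are continuous). [cite: Balaban1987RG1, (0.4) p.253 (bookkeeping)] -/
theorem isOpen_small (c : PBond P (j + 1)) :
    IsOpen {U : GaugeField P j (SU N) | BlockAveraging.Small (expMeanLogSU (n := Fin N)) U c} := by
  simp only [BlockAveraging.Small, setOf_forall]
  exact isOpen_iInter_of_finite fun i =>
    isOpen_lt (continuous_dist1_SU'.comp ((continuous_apply i).comp (continuous_loopHol c))) continuous_const

/-- ON the guard, the small-loop average of the loop variables is continuous in the configuration (`ExpMeanLog.continuousOn_coe_ESU` composed with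
the continuous loop variables). [cite: Balaban1987RG1, (0.4) p.253 (bookkeeping)] -/
theorem continuousOn_avg_loopHol (c : PBond P (j + 1)) :
    ContinuousOn (fun U : GaugeField P j (SU N) => (expMeanLogSU (n := Fin N)).avg (loopHol U c))
      {U | BlockAveraging.Small (expMeanLogSU (n := Fin N)) U c} := by
  have hW : Continuous fun U : GaugeField P j (SU N) => loopHol U c ∘ (LoopAverage.enum (Idx P)).symm :=
    continuous_pi fun k => (continuous_apply _).comp (continuous_loopHol c)
  have hE : ContinuousOn (fun W : Fin (Fintype.card (Idx P) - 1 + 1) → SU N => ESU W)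
      {W | ∀ k, dist1 (W k) < deltaSU (Fin N)} :=
    Topology.IsInducing.subtypeVal.continuousOn_iff.2 continuousOn_coe_ESU
  refine hE.comp hW.continuousOn fun U hU k => ?_
  exact hU _

/-- **The exp-mean-log block averaging of record is σ-closed-continuous**: at each coarse bond `c` the averaged variable `corr U c · U(c)` is
continuous on the open guard `{Small U c}` (there `corr = exp[mean log]` of the loop variables) and on its closed complement (there `corr = 1`),
so the total map `avgFun expMeanLogSU : SU(N)^{bonds_j} → SU(N)^{bonds_{j+1}}` is continuous on each member of a countable closed cover
(`SigmaClosedContinuous.of_isOpen`, `.pi`) — although it is NOT continuous (`BlockAveragingExpMeanLogContinuous`, header). [cite: Balaban1987RG1, (0.4) p.253 (bookkeeping)] -/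
theorem sigmaClosedContinuous_avgFun :
    SigmaClosedContinuous (avgFun (expMeanLogSU (n := Fin N)) : GaugeField P j (SU N) → GaugeField P (j + 1) (SU N)) := by
  haveI : MetrizableSpace (GaugeField P j (SU N)) := inferInstanceAs (MetrizableSpace (PBond P j → SU N))
  refine (SigmaClosedContinuous.pi fun c => ?_ :
    SigmaClosedContinuous fun (U : GaugeField P j (SU N)) (c : PBond P (j + 1)) => corr (expMeanLogSU (n := Fin N)) U c * axialAvg U c)
  have hax : Continuous fun U : GaugeField P j (SU N) => axialAvg U c := (continuous_apply c).comp continuous_axialAvg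
  refine SigmaClosedContinuous.of_isOpen (isOpen_small c) ?_ ?_
  · refine ((continuousOn_avg_loopHol c).mul hax.continuousOn).congr fun U hU => ?_
    have hU' : BlockAveraging.Small (expMeanLogSU (n := Fin N)) U c := hU
    show corr _ U c * axialAvg U c = (expMeanLogSU (n := Fin N)).avg (loopHol U c) * axialAvg U c
    unfold corr
    rw [if_pos hU']
  · refine hax.continuousOn.congr fun U hU => ?_
    have hU' : ¬ BlockAveraging.Small (expMeanLogSU (n := Fin N)) U c := hU
    show corr _ U c * axialAvg U c = axialAvg U c
    unfold corr
    rw [if_neg hU', one_mul]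

variable (F : T4Family) (N : ℕ) [NeZero N]

/-- Every iterate `M^k = Averaging.iter (avOfRecord F N K) k` of the averaging of record is σ-closed-continuous (composition). [cite: Balaban1987RG1, (0.11) p.253 (bookkeeping)] -/
theorem sigmaClosedContinuous_iter (K : ℕ) : ∀ k : ℕ, SigmaClosedContinuous (Averaging.iter (avOfRecord F N K) k)
  | 0 => SigmaClosedContinuous.of_continuous continuous_id
  | k + 1 => (sigmaClosedContinuous_avgFun (j := k)).comp (sigmaClosedContinuous_iter K k)

/-- The joint map `U ↦ (M^j U)_{j ≤ J}` to all levels up to `J` is σ-closed-continuous (finite product). [cite: Balaban1988Convergent, (2.11) p.256 (bookkeeping)] -/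
theorem sigmaClosedContinuous_iterUpTo (K J : ℕ) :
    SigmaClosedContinuous fun (U : GaugeField (F.P K) 0 (SU N)) (j : Fin (J + 1)) => Averaging.iter (avOfRecord F N K) j U :=
  SigmaClosedContinuous.pi fun j => sigmaClosedContinuous_iter F N K j

end Averaging

/-! ## §3 A measurable selector of the (2.12) minimisers of record -/

section Selector

variable (F : T4Family) (N : ℕ) [NeZero N]

/-- No bond meets the empty region. [cite: Balaban1987RG1, (0.1) p.251 (bookkeeping)] -/
theorem bondsOf_empty {P : Params} {j : ℕ} : bondsOf (∅ : Set (Site P j)) = ∅ := by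
  ext b
  simp [bondsOf]

/-- The (2.10) constraint on a determining set supported on scales `≤ J` reads on the levels `j ≤ J` only: `M_𝔹(U) = W on 𝔹` iff
`∀ j ≤ J, ∀ b ∈ bonds(Γ_j), M^j(U)(b) = W_j(b)`. [cite: Balaban1988Convergent, (2.10)–(2.11) p.256 (bookkeeping)] -/
theorem agreeOn_avgFamily_iff_fin {P : Params} {G : Type*} [GaugeGroup G] (av : ∀ j, Averaging P j G) {𝔹 : DetSet P} {J : ℕ}
    (h𝔹 : ∀ j, J < j → 𝔹 j = ∅) (U : GaugeField P 0 G) (W : MSField P G) :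
    AgreeOn 𝔹 (avgFamily av U) W ↔ ∀ j : Fin (J + 1), ∀ b ∈ bondsOf (𝔹 j), Averaging.iter av j U b = W j b := by
  constructor
  · intro h j b hb
    exact h j b hb
  · intro h j b hb
    by_cases hj : j ≤ J
    · exact h ⟨j, Nat.lt_succ_of_le hj⟩ b hb
    · rw [h𝔹 j (lt_of_not_ge hj), bondsOf_empty] at hb
      exact absurd hb (Set.notMem_empty b)

/-- **A MEASURABLE SELECTOR OF THE (2.12) MINIMISERS OF RECORD.**  For every torus `K` of the family, every threshold `δ` (regularity class
`{U | |U(∂p) − 1| < δ}`) and every determining set `𝔹` supported on scales `≤ J`, there is a MEASURABLE map `f` from multi-scale data to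
configurations such that `f W` is a minimal configuration of (2.12) — in def-R's exact sense `IsMinimizer (avOfRecord F N K) {PlaqSmall δ} 𝔹 W` —
whenever one exists, and `f W = 1` otherwise.  (Compactness of `SU(N)^{bonds}`, §1–§2, and the selection theorem
`Literature.MeasureTheory.RandomSets.exists_measurable_constrained_argmin`; existence ∕ uniqueness of minimisers — [Balaban1985PropagatorsII] Thm 1 —
is NOT used.) [cite: Balaban1988Convergent, (2.12) p.256] -/
theorem exists_measurable_isMinimizer_selector (K : ℕ) (δ : ℝ) (𝔹 : DetSet (F.P K)) (J : ℕ) (h𝔹 : ∀ j, J < j → 𝔹 j = ∅) :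
    ∃ f : MSField (F.P K) (SU N) → GaugeField (F.P K) 0 (SU N), Measurable f ∧
      (∀ W, (∃ U₀, IsMinimizer (avOfRecord F N K) {U | PlaqSmall δ U} 𝔹 W U₀) →
        IsMinimizer (avOfRecord F N K) {U | PlaqSmall δ U} 𝔹 W (f W)) ∧
      (∀ W, ¬ (∃ U₀, IsMinimizer (avOfRecord F N K) {U | PlaqSmall δ U} 𝔹 W U₀) → f W = 1) := by
  -- the configuration spaces `SU(N)^{bonds}` are compact Polish with Borel = product σ-algebra
  have hemb : Topology.IsClosedEmbedding (fundamentalRep (Fin N)) :=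
    (continuous_fundamentalRep (Fin N)).isClosedEmbedding (fundamentalRep_injective (Fin N))
  haveI : SecondCountableTopology (SU N) := by
    haveI := secondCountableTopology_matrix (n := Fin N)
    exact hemb.isEmbedding.secondCountableTopology
  haveI : PolishSpace (SU N) := by
    haveI : PolishSpace (Matrix (Fin N) (Fin N) ℂ) := inferInstanceAs (PolishSpace (Fin N → Fin N → ℂ))
    exact hemb.polishSpace
  haveI : ∀ j, CompactSpace (GaugeField (F.P K) j (SU N)) := fun j => inferInstanceAs (CompactSpace (PBond (F.P K) j → SU N))
  haveI : PolishSpace (GaugeField (F.P K) 0 (SU N)) := inferInstanceAs (PolishSpace (PBond (F.P K) 0 → SU N))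
  haveI : ∀ j, SecondCountableTopology (GaugeField (F.P K) j (SU N)) := fun j =>
    inferInstanceAs (SecondCountableTopology (PBond (F.P K) j → SU N))
  haveI : ∀ j, BorelSpace (GaugeField (F.P K) j (SU N)) := fun j => inferInstanceAs (BorelSpace (PBond (F.P K) j → SU N))
  -- the data map `π`, the piecewise-continuous constraint map `g`, the closed relation `R`
  let Z : Type := (j : Fin (J + 1)) → GaugeField (F.P K) j (SU N)
  let π : MSField (F.P K) (SU N) → Z := fun W j => W j
  let g : GaugeField (F.P K) 0 (SU N) → Z := fun U j => Averaging.iter (avOfRecord F N K) j U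
  let R : Set (Z × Z) := {p | ∀ j : Fin (J + 1), ∀ b ∈ bondsOf (𝔹 j), p.1 j b = p.2 j b}
  have hπ : Measurable π := measurable_pi_lambda _ fun j => measurable_pi_apply _
  have hg : SigmaClosedContinuous g := sigmaClosedContinuous_iterUpTo F N K J
  have hcoord : ∀ (j : Fin (J + 1)) (b : PBond (F.P K) j), Continuous fun z : Z => z j b := fun j b =>
    (show Continuous fun V : GaugeField (F.P K) j (SU N) => V b from continuous_apply b).comp (continuous_apply j)
  have hR : IsClosed R := by
    simp only [R, setOf_forall]
    refine isClosed_iInter fun j => isClosed_iInter fun b => isClosed_iInter fun _ => ?_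
    exact isClosed_eq ((hcoord j b).comp continuous_fst) ((hcoord j b).comp continuous_snd)
  have hadm : ∀ (U : GaugeField (F.P K) 0 (SU N)) (W : MSField (F.P K) (SU N)),
      (U ∈ {U : GaugeField (F.P K) 0 (SU N) | PlaqSmall δ U} ∧ (g U, π W) ∈ R) ↔
        (U ∈ {U : GaugeField (F.P K) 0 (SU N) | PlaqSmall δ U} ∧ AgreeOn 𝔹 (avgFamily (avOfRecord F N K) U) W) :=
    fun U W => and_congr Iff.rfl (agreeOn_avgFamily_iff_fin (avOfRecord F N K) h𝔹 U W).symm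
  obtain ⟨f, hfm, hfin, hfout⟩ := exists_measurable_constrained_argmin hπ hg (isOpen_plaqSmall δ) hR
    (continuous_wilsonAction4' (N := N) (P := F.P K) (j := 0)) (1 : GaugeField (F.P K) 0 (SU N))
  refine ⟨f, hfm, fun W hW => ?_, fun W hW => ?_⟩
  · obtain ⟨U₀, hreg, hagree, hmin⟩ := hW
    have hex : ∃ y, (y ∈ {U : GaugeField (F.P K) 0 (SU N) | PlaqSmall δ U} ∧ (g y, π W) ∈ R) ∧
        ∀ z, z ∈ {U : GaugeField (F.P K) 0 (SU N) | PlaqSmall δ U} ∧ (g z, π W) ∈ R → wilsonAction4 y ≤ wilsonAction4 z :=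
      ⟨U₀, (hadm U₀ W).mpr ⟨hreg, hagree⟩, fun z hz => hmin z ((hadm z W).mp hz).1 ((hadm z W).mp hz).2⟩
    obtain ⟨hf₁, hf₂⟩ := hfin W hex
    obtain ⟨hfreg, hfagree⟩ := (hadm (f W) W).mp hf₁
    exact ⟨hfreg, hfagree, fun U hU hUa => hf₂ U ((hadm U W).mpr ⟨hU, hUa⟩)⟩
  · refine hfout W fun h => hW ?_
    obtain ⟨y, hy, hmin⟩ := h
    obtain ⟨hyreg, hyagree⟩ := (hadm y W).mp hy
    exact ⟨y, hyreg, hyagree, fun U hU hUa => hmin U ((hadm U W).mpr ⟨hU, hUa⟩)⟩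

end Selector

/-! ## §4 THE OFFER: the (2.12) solution map through a measurable selector, same interface as `UminOfRecord`, and (H-U) for it -/

section Offer

variable {P : Params} {G : Type*} [GaugeGroup G] [MeasurableSpace G] (av : ∀ j, Averaging P j G) (reg : Set (GaugeField P 0 G))

open Classical in
/-- **The (2.12) solution map of record THROUGH A MEASURABLE SELECTOR** (offered re-point of def-R's `UminOfRecord`, one token): if a measurable
map selecting a minimiser of (2.12) wherever one exists (and `1` elsewhere) EXISTS for `(av, reg, 𝔹)`, a fixed such map (one global choice of a
FUNCTION); otherwise def-R's pointwise choice `UminOfRecord`.  Same values-level contract as `UminOfRecord`: a minimiser on the solvable set, the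
unit configuration off it. [cite: Balaban1988Convergent, (2.12) p.256] -/
def UminSelOfRecord (𝔹 : DetSet P) : MSField P G → GaugeField P 0 G :=
  if h : ∃ f : MSField P G → GaugeField P 0 G, Measurable f ∧
      (∀ W, (∃ U₀, IsMinimizer av reg 𝔹 W U₀) → IsMinimizer av reg 𝔹 W (f W)) ∧
      (∀ W, ¬ (∃ U₀, IsMinimizer av reg 𝔹 W U₀) → f W = 1)
  then Classical.choose h else UminOfRecord av reg 𝔹

/-- On the solvable set the selected configuration IS a minimiser of (2.12) (the interface lemma of `UminOfRecord`, verbatim). [cite: Balaban1988Convergent, (2.12) p.256] -/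
theorem isMinimizer_UminSelOfRecord {𝔹 : DetSet P} {W : MSField P G} (h : ∃ U₀, IsMinimizer av reg 𝔹 W U₀) :
    IsMinimizer av reg 𝔹 W (UminSelOfRecord av reg 𝔹 W) := by
  unfold UminSelOfRecord
  split_ifs with hsel
  · exact (Classical.choose_spec hsel).2.1 W h
  · exact isMinimizer_UminOfRecord av reg h

/-- Off the solvable set the selected configuration is the unit configuration (the documented junk default, as for `UminOfRecord`).
[cite: Balaban1988Convergent, (2.12) p.256 (typing convention)] -/
theorem UminSelOfRecord_of_not {𝔹 : DetSet P} {W : MSField P G} (h : ¬ ∃ U₀, IsMinimizer av reg 𝔹 W U₀) :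
    UminSelOfRecord av reg 𝔹 W = fun _ => 1 := by
  unfold UminSelOfRecord
  split_ifs with hsel
  · exact (Classical.choose_spec hsel).2.2 W h
  · exact UminOfRecord_of_not av reg h

/-- The NEW interface lemma: whenever a measurable selector exists for `(av, reg, 𝔹)`, `UminSelOfRecord av reg 𝔹` is measurable.
[cite: Balaban1988Convergent, (2.12) p.256 (bookkeeping)] -/
theorem measurable_UminSelOfRecord_of_exists {𝔹 : DetSet P}
    (h : ∃ f : MSField P G → GaugeField P 0 G, Measurable f ∧
      (∀ W, (∃ U₀, IsMinimizer av reg 𝔹 W U₀) → IsMinimizer av reg 𝔹 W (f W)) ∧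
      (∀ W, ¬ (∃ U₀, IsMinimizer av reg 𝔹 W U₀) → f W = 1)) :
    Measurable (UminSelOfRecord av reg 𝔹) := by
  unfold UminSelOfRecord
  rw [dif_pos h]
  exact (Classical.choose_spec h).1

/-- **The (2.12) solution datum of record through the selector**, as r12's `DetBackground`: same regularity class, same solvable domain as
`bgOfRecord`, solution map `UminSelOfRecord`, minimising property PROVED on the domain. [cite: Balaban1988Convergent, (2.12) p.256] -/
def bgSelOfRecord : DetBackground P G av where
  reg := reg
  dom := solvableDom av reg
  U := UminSelOfRecord av reg
  isMinimizer := fun _ _ h => isMinimizer_UminSelOfRecord av reg h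

/-- Unfolding: the solution map of the re-pointed datum. [cite: Balaban1988Convergent, (2.12) p.256 (bookkeeping)] -/
theorem bgSelOfRecord_U : (bgSelOfRecord av reg).U = UminSelOfRecord av reg := rfl

/-- Unfolding: the domain of the re-pointed datum is the solvable set (as for `bgOfRecord`). [cite: Balaban1988Convergent, (2.12) p.256 (bookkeeping)] -/
theorem bgSelOfRecord_dom : (bgSelOfRecord av reg).dom = solvableDom av reg := rfl

/-- Unfolding: the regularity class of the re-pointed datum. [cite: Balaban1988Convergent, (2.12) p.256 (bookkeeping)] -/
theorem bgSelOfRecord_reg : (bgSelOfRecord av reg).reg = reg := rfl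

end Offer

section AtRecord

variable (F : T4Family) (N : ℕ) [NeZero N]

/-- `𝐁_k(□)` has no member above the top scale `k`. [cite: Balaban1988Convergent, (2.13) pp.256–257 (bookkeeping)] -/
theorem Bj_eq_empty_of_lt {P : Params} (M₁ : ℕ) (box4 : Set (Site P 0)) {k j : ℕ} (h : k < j) : Bj M₁ box4 k j = ∅ := by
  rw [Bj_apply, gammaRegion_of_gt _ h]
  rfl

/-- **At every determining set of record the re-pointed solution map is MEASURABLE** (`SU(N)`, the averaging of record, any threshold).
[cite: Balaban1988Convergent, (2.12)–(2.13) pp.256–257] -/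
theorem measurable_UminSelOfRecord (K k : ℕ) (δ : ℝ) (M₁ : ℕ) (box4 : Set (Site (F.P K) 0)) :
    Measurable (UminSelOfRecord (avOfRecord F N K) {U | PlaqSmall δ U} (Bj M₁ box4 k)) :=
  measurable_UminSelOfRecord_of_exists _ _
    (exists_measurable_isMinimizer_selector F N K δ (Bj M₁ box4 k) k fun _ hj => Bj_eq_empty_of_lt M₁ box4 hj)

/-- The one-step pull-back (1.3) `Q^{s*}` is measurable (each bond variable is `1` or a bond variable of `V`). [folklore] -/
private theorem measurable_qsstarG' {P : Params} {j : ℕ} {G : Type*} [MeasurableSpace G] [One G] :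
    Measurable (qsstarG : GaugeField P (j + 1) G → GaugeField P j G) := by
  refine measurable_pi_iff.mpr fun b => ?_
  by_cases h : blockOf b.tgt = blockOf b.src
  · simp only [qsstarG_apply, if_pos h]; exact measurable_const
  · simp only [qsstarG_apply, if_neg h]; exact measurable_pi_apply _

/-- `Q^{s*}_k` is measurable. [folklore] -/
private theorem measurable_qsstarGIter0' {P : Params} {G : Type*} [MeasurableSpace G] [One G] :
    ∀ k : ℕ, Measurable (qsstarGIter0 k : GaugeField P k G → GaugeField P 0 G)
  | 0 => measurable_id
  | k + 1 => by
    rw [show (qsstarGIter0 (k + 1) : GaugeField P (k + 1) G → GaugeField P 0 G) = fun V => qsstarGIter0 k (qsstarG V) from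
      funext fun V => qsstarGIter0_succ k V]
    exact (measurable_qsstarGIter0' k).comp measurable_qsstarG'

/-- **(H-U) FOR THE RE-POINTED DATUM IS A THEOREM**: every local background (2.16) `V_k ↦ U_{k,□}(V_k) = U(𝐁_k(□), M˙(Q_k^{s*}V_k))` over
`bgSelOfRecord` — the regularity class `{|U(∂p) − 1| < εreg·η_k²}` of record, layer width `M₁` — is a measurable map of the field, for every
torus `K`, level `k` and cube `□`: literally `Record12Measurability.LocalBgMeasurable F N ν` with `bgOfRecord ↦ bgSelOfRecord`.
[cite: Balaban1988Convergent, (2.16) p.257] -/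
theorem measurable_ukBox_bgSel (ν : Stage7Numerics) (K k : ℕ) (box4 : Set (Site (F.P K) 0)) :
    Measurable (ukBox (bgSelOfRecord (avOfRecord F N K)
      {U : GaugeField (F.P K) 0 (SU N) | PlaqSmall (ν.εreg * (F.P K).eta k ^ 2) U}) ν.M₁ box4 k) := by
  have hM : Measurable (avgFamily (avOfRecord F N K) : GaugeField (F.P K) 0 (SU N) → MSField (F.P K) (SU N)) :=
    measurable_pi_lambda _ fun j => measurable_iter (avOfRecord F N K) (avOfRecord_measurable F N K) j
  exact (measurable_UminSelOfRecord F N K k _ ν.M₁ box4).comp (hM.comp (measurable_qsstarGIter0' k))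

end AtRecord

/-! ## §6 (v1.1, g3) THE DETERMINED SELECTOR: a measurable selector that reads the data ON `𝔹` ONLY — hence is a function of the MINIMAL ORBIT — and the
corresponding face of def-R's pointwise choice `UminOfRecord` (equal (2.12) predicates ⇒ equal values), by name -/

section Determined

variable {P : Params} {G : Type*} [GaugeGroup G] (av : ∀ j, Averaging P j G) (reg : Set (GaugeField P 0 G))

/-- **def-R's POINTWISE CHOICE `UminOfRecord` IS A FUNCTION OF THE (2.12) PREDICATE**: two data `W`, `W′` with the same minimal configurations (as a predicate on
`U`) get the same chosen configuration — the choice reads `W` only through the proposition `∃ U₀, IsMinimizer … W U₀` and its witness predicate (`propext` ∕ `funext`;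
the argument of dag-n13-e's `B16Thm1BaseAtRecord11.UbgOfRecord_zero_const`, isolated BY NAME so that consumers need not unfold the definition).
[cite: Balaban1988Convergent, (2.12) p.256 (bookkeeping over the tree's typing convention)] -/
theorem UminOfRecord_congr_of_isMinimizer_iff [MeasurableSpace G] {𝔹 : DetSet P} {W W' : MSField P G}
    (h : ∀ U₀, IsMinimizer av reg 𝔹 W U₀ ↔ IsMinimizer av reg 𝔹 W' U₀) :
    UminOfRecord av reg 𝔹 W = UminOfRecord av reg 𝔹 W' := by
  -- v1.2 (REBALANCE №62 S2′, def-R S5-LETTERS): ONE instance binder `[MeasurableSpace G]` added to the SIGNATURE ahead of FILE 1 v2′ (director-ym №128 D1 (B)),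
  -- under which `UminOfRecord` sits below `variable [MeasurableSpace G]`; the proof is unchanged and survives v2′ (the data enter the body only through the
  -- (2.12) predicate in both branches — def-R probe `probe_K0c_congr`).
  have hpred : IsMinimizer av reg 𝔹 W = IsMinimizer av reg 𝔹 W' := funext fun U₀ => propext (h U₀)
  unfold UminOfRecord
  rw [hpred]

/-- **Two SOLVABLE data with the same (2.12) minimal configurations AGREE ON `𝔹`** (a common minimiser `U₀` has `M_𝔹(U₀) = W` and `= W′` on `𝔹`).
[cite: Balaban1988Convergent, (2.10)–(2.12) p.256 (bookkeeping)] -/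
theorem agreeOn_of_isMinimizer_iff_of_exists {𝔹 : DetSet P} {W W' : MSField P G}
    (h : ∀ U₀, IsMinimizer av reg 𝔹 W U₀ ↔ IsMinimizer av reg 𝔹 W' U₀) (hW : ∃ U₀, IsMinimizer av reg 𝔹 W U₀) :
    AgreeOn 𝔹 W W' := by
  obtain ⟨U₀, hU₀⟩ := hW
  intro j b hb
  rw [← hU₀.2.1 j b hb, ← ((h U₀).mp hU₀).2.1 j b hb]

end Determined

section DeterminedSelector

variable (F : T4Family) (N : ℕ) [NeZero N]

/-- **A MEASURABLE SELECTOR OF THE (2.12) MINIMISERS OF RECORD THAT IS A FUNCTION OF THE MINIMAL ORBIT** (v1.1): as `exists_measurable_isMinimizer_selector`,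
and moreover DETERMINED — `f W = f W′` whenever `W`, `W′` have the same (2.12) minimal configurations (in particular whenever they agree on `𝔹`; at `𝔹 = ∅` the map
is CONSTANT).  Construction: §3's selector precomposed with the projection of the data onto the bonds of `𝔹` (unit elsewhere), which is measurable and does not
change the (2.10) constraint; equal non-empty minimal orbits force agreement on `𝔹` (`agreeOn_of_isMinimizer_iff_of_exists`), equal empty ones give `1 = 1`.  This is
the extra values-level clause under which EVERY face the tree proves of def-R's pointwise choice (`isMinimizer_UminOfRecord`, `UminOfRecord_of_not`,
`UminOfRecord_congr_of_isMinimizer_iff`) holds for the selector as well.  Existence ∕ uniqueness of minimisers ([Balaban1985PropagatorsII] Thm 1) NOT used.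
[cite: Balaban1988Convergent, (2.10)–(2.12) p.256] -/
theorem exists_measurable_isMinimizer_selector_determined (K : ℕ) (δ : ℝ) (𝔹 : DetSet (F.P K)) (J : ℕ) (h𝔹 : ∀ j, J < j → 𝔹 j = ∅) :
    ∃ f : MSField (F.P K) (SU N) → GaugeField (F.P K) 0 (SU N), Measurable f ∧
      (∀ W, (∃ U₀, IsMinimizer (avOfRecord F N K) {U | PlaqSmall δ U} 𝔹 W U₀) →
        IsMinimizer (avOfRecord F N K) {U | PlaqSmall δ U} 𝔹 W (f W)) ∧
      (∀ W, ¬ (∃ U₀, IsMinimizer (avOfRecord F N K) {U | PlaqSmall δ U} 𝔹 W U₀) → f W = 1) ∧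
      (∀ W W', (∀ U₀, IsMinimizer (avOfRecord F N K) {U | PlaqSmall δ U} 𝔹 W U₀ ↔ IsMinimizer (avOfRecord F N K) {U | PlaqSmall δ U} 𝔹 W' U₀) →
        f W = f W') := by
  classical
  obtain ⟨f₀, hf₀m, hf₀in, hf₀out⟩ := exists_measurable_isMinimizer_selector F N K δ 𝔹 J h𝔹
  -- the projection of the data onto the bonds of `𝔹` (unit elsewhere)
  let π : MSField (F.P K) (SU N) → MSField (F.P K) (SU N) := fun W j b => if b ∈ bondsOf (𝔹 j) then W j b else 1
  have hπm : Measurable π := by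
    refine measurable_pi_lambda _ fun j => measurable_pi_lambda _ fun b => ?_
    by_cases hb : b ∈ bondsOf (𝔹 j)
    · simp only [π, if_pos hb]
      exact (measurable_pi_apply b).comp (measurable_pi_apply j)
    · simp only [π, if_neg hb]
      exact measurable_const
  -- the (2.10) constraint, hence the (2.12) predicate, does not see the projection
  have hagree : ∀ (V W : MSField (F.P K) (SU N)), AgreeOn 𝔹 V (π W) ↔ AgreeOn 𝔹 V W := fun V W => by
    refine forall_congr' fun j => forall_congr' fun b => forall_congr' fun hb => ?_
    simp only [π, if_pos hb]
  have hmin : ∀ (W : MSField (F.P K) (SU N)) (U₀ : GaugeField (F.P K) 0 (SU N)),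
      IsMinimizer (avOfRecord F N K) {U | PlaqSmall δ U} 𝔹 (π W) U₀ ↔ IsMinimizer (avOfRecord F N K) {U | PlaqSmall δ U} 𝔹 W U₀ := fun W U₀ => by
    simp only [IsMinimizer, hagree]
  -- equal minimal orbits give equal projections
  have hπeq : ∀ W W' : MSField (F.P K) (SU N),
      (∀ U₀, IsMinimizer (avOfRecord F N K) {U | PlaqSmall δ U} 𝔹 W U₀ ↔ IsMinimizer (avOfRecord F N K) {U | PlaqSmall δ U} 𝔹 W' U₀) →
      (∃ U₀, IsMinimizer (avOfRecord F N K) {U | PlaqSmall δ U} 𝔹 W U₀) → π W = π W' := fun W W' h hW => by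
    have hWW' : AgreeOn 𝔹 W W' := agreeOn_of_isMinimizer_iff_of_exists (avOfRecord F N K) _ h hW
    funext j b
    by_cases hb : b ∈ bondsOf (𝔹 j)
    · simp only [π, if_pos hb]
      exact hWW' j b hb
    · simp only [π, if_neg hb]
  refine ⟨f₀ ∘ π, hf₀m.comp hπm, fun W hW => ?_, fun W hW => ?_, fun W W' h => ?_⟩
  · exact (hmin W _).mp (hf₀in (π W) (by obtain ⟨U₀, hU₀⟩ := hW; exact ⟨U₀, (hmin W U₀).mpr hU₀⟩))
  · exact hf₀out (π W) fun ⟨U₀, hU₀⟩ => hW ⟨U₀, (hmin W U₀).mp hU₀⟩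
  · by_cases hW : ∃ U₀, IsMinimizer (avOfRecord F N K) {U | PlaqSmall δ U} 𝔹 W U₀
    · show f₀ (π W) = f₀ (π W')
      rw [hπeq W W' h hW]
    · have hW' : ¬ ∃ U₀, IsMinimizer (avOfRecord F N K) {U | PlaqSmall δ U} 𝔹 W' U₀ := fun ⟨U₀, hU₀⟩ => hW ⟨U₀, (h U₀).mpr hU₀⟩
      show f₀ (π W) = f₀ (π W')
      rw [hf₀out (π W) fun ⟨U₀, hU₀⟩ => hW ⟨U₀, (hmin W U₀).mp hU₀⟩,
        hf₀out (π W') fun ⟨U₀, hU₀⟩ => hW' ⟨U₀, (hmin W' U₀).mp hU₀⟩]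

/-- … at the determining sets of record `𝐁_k(□)` (supported on scales `≤ k`), every threshold. [cite: Balaban1988Convergent, (2.12)–(2.13) pp.256–257] -/
theorem exists_measurable_isMinimizer_selector_determined_Bj (K k : ℕ) (δ : ℝ) (M₁ : ℕ) (box4 : Set (Site (F.P K) 0)) :
    ∃ f : MSField (F.P K) (SU N) → GaugeField (F.P K) 0 (SU N), Measurable f ∧
      (∀ W, (∃ U₀, IsMinimizer (avOfRecord F N K) {U | PlaqSmall δ U} (Bj M₁ box4 k) W U₀) →
        IsMinimizer (avOfRecord F N K) {U | PlaqSmall δ U} (Bj M₁ box4 k) W (f W)) ∧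
      (∀ W, ¬ (∃ U₀, IsMinimizer (avOfRecord F N K) {U | PlaqSmall δ U} (Bj M₁ box4 k) W U₀) → f W = 1) ∧
      (∀ W W', (∀ U₀, IsMinimizer (avOfRecord F N K) {U | PlaqSmall δ U} (Bj M₁ box4 k) W U₀ ↔
          IsMinimizer (avOfRecord F N K) {U | PlaqSmall δ U} (Bj M₁ box4 k) W' U₀) → f W = f W') :=
  exists_measurable_isMinimizer_selector_determined F N K δ (Bj M₁ box4 k) k fun _ hj => Bj_eq_empty_of_lt M₁ box4 hj

end DeterminedSelector

end Literature.MathematicalPhysics.QuantumFieldTheory.Balaban1983to89.Node00
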